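import Summits.RiemannHypothesis.RiemannHypothesis.Theses.SpectralTrace
import Literature.NumberTheory.LFunctions.RiemannSiegel
import Literature.NumberTheory.LFunctions.WeilMellinBounds
import Summits.RiemannHypothesis.RiemannHypothesis.Theorems.WindowTraceArch.Negative.FiniteSpectrum
import Summits.RiemannHypothesis.RiemannHypothesis.Theorems.WindowTraceArch.Negative.BoundedDensity
import Summits.RiemannHypothesis.RiemannHypothesis.Theorems.WindowTraceArch.Negative.UnitMass
import Summits.RiemannHypothesis.RiemannHypothesis.Theorems.WindowTraceArch.Negative.LocalWeyl
import Summits.RiemannHypothesis.RiemannHypothesis.Theorems.WindowTraceArch.Negative.WithoutIsWeilTest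
import Summits.RiemannHypothesis.RiemannHypothesis.Theorems.SpectralTraceWindowTraceArchStubBase
import Summits.RiemannHypothesis.RiemannHypothesis.Theorems.SpectralTraceWindowTraceArchStubAcuteAngle
import Summits.RiemannHypothesis.RiemannHypothesis.Theorems.SpectralTraceWindowTraceArchStubDomination
import Summits.RiemannHypothesis.RiemannHypothesis.Theorems.SpectralTraceWindowTraceArchStubCompactness
import Summits.RiemannHypothesis.RiemannHypothesis.Theorems.SpectralTraceWindowTraceArchStubDenseFamily
import Summits.RiemannHypothesis.RiemannHypothesis.Theorems.SpectralTraceWindowTraceArchStubExtensionOfDense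
import Literature.Analysis.Fourier.SelbergMajorantsFourier
import Summits.RiemannHypothesis.RiemannHypothesis.Theorems.SpectralTraceWindowTraceArchStubBandlimitedTest
import Summits.RiemannHypothesis.RiemannHypothesis.Theorems.SpectralTraceWindowTraceArchStubSelbergTests
import Summits.RiemannHypothesis.RiemannHypothesis.Theorems.SpectralTraceWindowTraceArchStubCountingLaw
import Summits.RiemannHypothesis.RiemannHypothesis.Theorems.SpectralTraceWindowTraceArchStubSortedEnumeration
import Summits.RiemannHypothesis.RiemannHypothesis.Theorems.SpectralTraceWindowTraceArchStubDisplacementBound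
import Summits.RiemannHypothesis.RiemannHypothesis.Theorems.SpectralTraceWindowTraceArchStubStructureAssembly

/-!
# Line `defect-compactness-design` for the crux `WindowTraceArch` (stmt-RiemannHypothesis-11195)

Lead's skeleton (line lead `prover-line-stmt-RiemannHypothesis-11195-0`, 2026-08-16), RESHAPED from
the crux-plan skeleton `Lines/defect_compactness_design.lean` (5 stubs) into 7 registered stubs with
the SAME composition idea: `stub_extension` is split into a dense-family stub and a continuity stub,
and the Mellin-decay/profile-summability lemma shared by the compactness and continuity steps is
factored out as `stub_domination` (taken as a hypothesis by both consumers, exactly as `stub_design`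
takes `stub_acuteAngle`). Idea card: `Cruxes/WindowTraceArch/Ideas/defect-compactness-design`.

THE LINE. A witness of the archimedean rung is obtained as a BOUNDED DISPLACEMENT
`n ↦ x n + δ n` (`|δ n| ≤ D`) of ONE explicit log-sparse base configuration, the symmetric
França–LeClair lattice `FL = {t : 7 ≤ |t|, cos θ(t) = 0}` (`θ` = `riemannSiegelTheta`; its positive
points are the increasing-branch solutions of `θ(xₙ) = (n - 3/2)π`: 14.52, 20.65, 25.49, 29.74, …):

* `stub_design` (the engine, HARDEST, held by the lead): for every FINITE list of window Weil tests
  there is a bounded-displacement "design" of `FL` — unit atoms, equal weights — reproducing `W`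
  EXACTLY on that list, with ONE displacement budget `D` for all lists (Bondarenko–Radchenko–Viazovska
  existence: push atoms along the gradient of a test combination and close with the acute-angle form of
  Brouwer's theorem, `stub_acuteAngle`, in the dimension of the test list);
* `stub_compactness` (Lemma DC, soft): bounded displacements live in the compact metrisable cube
  `[-D, D]^ℕ`; along a diagonal subsequence the designs converge atom by atom, and exactness on each
  fixed test passes to the limit by dominated convergence of the series (domination = `stub_domination`)
  — integrality is automatic because atoms stay atoms;
* `stub_denseFamily` + `stub_extensionOfDense` (soft): a countable family of window tests dense in
  every `C^k` sup-seminorm exists, and both `g ↦ Σₙ ĝ(½ + iγₙ)` (for any poly-profile family, by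
  `stub_domination`) and `g ↦ W(g)` are continuous there, so exactness on the dense family is exactness
  on the window;
* `stub_domination` (soft, shared): for a poly-profile configuration `x` and a budget `D`, the values
  `ĝ(½ + i(xₙ + v))`, `|v| ≤ D`, are dominated by a summable sequence with sum
  `≤ K (‖g‖₁ + ‖g^{(k)}‖₁)` (`k` integrations by parts, `weilMellin_deriv`, + the count profile);
* `stub_base` supplies the enumeration and the log-sparsity of `FL`; `stub_acuteAngle` is the tree's
  `Brouwer.exists_zero_of_inner_nonneg_on_sphere` transported to `Fin m → ℝ`.

The composition `WindowTraceArch_of` is kernel-checked below; sorries occur only inside `stub_*`.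

TRUTH STATUS. `stub_base`, `stub_acuteAngle`, `stub_domination`, `stub_compactness`,
`stub_denseFamily`, `stub_extensionOfDense`: classical analysis/topology, provable now.
`stub_design`: RH-implied (under RH the order-preserving matching `±xₙ ↦ ±γₙ` between `FL` and the zeta
ordinates with multiplicity is a bounded displacement, `|γₙ - xₙ| ≪ (1 + |S(γₙ)|)/log γₙ ≪ 1` by
`S(T) = O(log T)`, and it is exact on ALL tests by `Negative.ComplexSpectrum.hasSum_weilMellin_zeros`),
so no stub is refutable short of `¬ RH`, and no stub is an instance refuted by the landed `Negative/*`
lemmas (imported above as a scratch check).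

DISPROOF USED (`Cruxes/WindowTraceArch/Disproof.lean` @c7e023ae5613, cycle 2, read 2026-08-16T06:15Z).
§1 `windowTraceArch_false_without_isWeilTest`: `IsWeilTest` is used at `stub_domination` (decay of `ĝ`
= smoothness) and at `stub_extensionOfDense` (`W` reads point values, `weilFunctional_spike`).
`windowTraceArchWithoutWindow_iff_spectralThesis`: the window enters at `stub_denseFamily` /
`stub_extensionOfDense` (density in `𝒟_K`, `K` the closed window) and at `stub_design` (designs are
asked only for window tests). §4 `LowZone.eleven_le_abs_of_windowTraceArch_witness`: every exact
displaced family has `|x n + δ n| ≥ 11`; consistent (first `FL` atom `14.52`, designs move it by `< 1`)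
and a constraint the engine of `stub_design` must respect. §5 (disprover's reading of this line): no
stub cheaply false; `stub_base` TRUE via `strictMonoOn_riemannSiegelTheta_Ici_seven`.
-/

set_option linter.dupNamespace false

noncomputable section

open Complex Filter Set MeasureTheory
open scoped Real Topology BigOperators

namespace Summit.RiemannHypothesis.RiemannHypothesis.Cruxes.WindowTraceArch.DefectCompactnessDesign

open Literature.NumberTheory.LFunctions
open Summit.RiemannHypothesis.RiemannHypothesis.Theses.SpectralTrace

/-! ## The statements (named `Prop`s; the registered `stub_*` theorems below restate them verbatim
and fully qualified; `Registered.stub_*` are the name-keyed aliases taken as hypotheses of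
`WindowTraceArch_of`) -/

/-- The symmetric França–LeClair lattice `FL = {t : 7 ≤ |t| ∧ cos θ(t) = 0}` (documentation
constant; the registered signatures inline the set). -/
def francaLeClair : Set ℝ := {t : ℝ | 7 ≤ |t| ∧ Real.cos (riemannSiegelTheta t) = 0}

/-- Polynomial local count profile of a configuration `x : ℕ → ℝ`: at most `C (1+|T|)^N` indices
`n` have `x n ∈ [T-1, T+1]` (phrased over finsets, so that no finiteness is presupposed). -/
def PolyProfile (x : ℕ → ℝ) (C : ℝ) (N : ℕ) : Prop :=
  ∀ (T : ℝ) (s : Finset ℕ), (∀ n ∈ s, |x n - T| ≤ 1) → (s.card : ℝ) ≤ C * (1 + |T|) ^ N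

/-- Statement of `stub_base`: `FL` is injectively enumerated by `ℕ` and log-sparse (polynomial
local count profile). -/
def BaseStatement : Prop :=
    ∃ x : ℕ → ℝ, Function.Injective x ∧
      Set.range x = francaLeClair ∧
      ∃ (C : ℝ) (N : ℕ), PolyProfile x C N

/-- Statement of `stub_acuteAngle`: the acute-angle form of Brouwer's fixed-point theorem on
`Fin m → ℝ`. -/
def AcuteAngleStatement : Prop :=
    ∀ (m : ℕ) (R : ℝ), 0 < R → ∀ f : (Fin m → ℝ) → (Fin m → ℝ), Continuous f →
      (∀ c : Fin m → ℝ, ∑ i, c i ^ 2 = R ^ 2 → 0 ≤ ∑ i, c i * f c i) →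
      ∃ c : Fin m → ℝ, ∑ i, c i ^ 2 ≤ R ^ 2 ∧ f c = 0

/-- Statement of `stub_design`: given the acute-angle lemma, bounded-displacement designs of `FL`
exist for every finite list of window tests, with one budget `D`. -/
def DesignStatement : Prop :=
    AcuteAngleStatement →
    ∀ x : ℕ → ℝ, Function.Injective x →
      Set.range x = francaLeClair →
      ∃ D : ℝ, ∀ (g : ℕ → ℝ → ℂ) (m : ℕ),
        (∀ j, IsWeilTest (g j) ∧ tsupport (g j) ⊆ Icc (-Real.log 2) (Real.log 2)) →
        ∃ δ : ℕ → ℝ, (∀ n, |δ n| ≤ D) ∧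
          ∀ j < m, HasSum (fun n => weilMellin (g j) (1 / 2 + ((x n + δ n : ℝ) : ℂ) * I))
            (weilFunctional (g j))

/-- Statement of `stub_domination` (shared analytic lemma): along a poly-profile configuration and
inside a displacement budget `D`, the transform of a Weil test is dominated by a summable sequence
whose sum is controlled by `‖f‖₁ + ‖f^{(k)}‖₁`. -/
def DominationStatement : Prop :=
    ∀ (x : ℕ → ℝ) (C D : ℝ) (N : ℕ), PolyProfile x C N →
      ∃ (K : ℝ) (k : ℕ), ∀ f : ℝ → ℂ, IsWeilTest f →
        ∃ b : ℕ → ℝ, Summable b ∧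
          (∀ (n : ℕ) (v : ℝ), |v| ≤ D →
            ‖weilMellin f (1 / 2 + ((x n + v : ℝ) : ℂ) * I)‖ ≤ b n) ∧
          ∑' n, b n ≤ K * ((∫ t, ‖f t‖) + ∫ t, ‖iteratedDeriv k f t‖)

/-- Statement of `stub_compactness` (Lemma DC, displacement form), given domination. -/
def CompactnessStatement : Prop :=
    DominationStatement →
    ∀ (x : ℕ → ℝ) (C D : ℝ) (N : ℕ) (g : ℕ → ℝ → ℂ) (δ : ℕ → ℕ → ℝ),
      PolyProfile x C N →
      (∀ j, IsWeilTest (g j)) → (∀ k n, |δ k n| ≤ D) →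
      (∀ j, ∀ᶠ k in atTop,
        HasSum (fun n => weilMellin (g j) (1 / 2 + ((x n + δ k n : ℝ) : ℂ) * I))
          (weilFunctional (g j))) →
      ∃ δ' : ℕ → ℝ, (∀ n, |δ' n| ≤ D) ∧
        ∀ j, HasSum (fun n => weilMellin (g j) (1 / 2 + ((x n + δ' n : ℝ) : ℂ) * I))
          (weilFunctional (g j))

/-- Density of a countable family `g` of window tests in every `C^k` sup-seminorm of the space of
Weil tests supported in the closed window. -/
def IsDenseWindowFamily (g : ℕ → ℝ → ℂ) : Prop :=
    (∀ j, IsWeilTest (g j) ∧ tsupport (g j) ⊆ Icc (-Real.log 2) (Real.log 2)) ∧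
    ∀ f : ℝ → ℂ, IsWeilTest f → tsupport f ⊆ Icc (-Real.log 2) (Real.log 2) →
      ∀ (k : ℕ) (ε : ℝ), 0 < ε → ∃ j, ∀ i ≤ k, ∀ t : ℝ, ‖iteratedDeriv i (f - g j) t‖ ≤ ε

/-- Statement of `stub_denseFamily`: a dense countable family of window tests exists. -/
def DenseFamilyStatement : Prop :=
    ∃ g : ℕ → ℝ → ℂ, IsDenseWindowFamily g

/-- Statement of `stub_extensionOfDense`: given domination, exactness of a bounded displacement of a
poly-profile configuration on a dense family of window tests extends to every window test. -/
def ExtensionOfDenseStatement : Prop :=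
    DominationStatement →
    ∀ g : ℕ → ℝ → ℂ, IsDenseWindowFamily g →
      ∀ (x : ℕ → ℝ) (C D : ℝ) (N : ℕ) (δ : ℕ → ℝ),
        PolyProfile x C N → (∀ n, |δ n| ≤ D) →
        (∀ j, HasSum (fun n => weilMellin (g j) (1 / 2 + ((x n + δ n : ℝ) : ℂ) * I))
          (weilFunctional (g j))) →
        ∀ f : ℝ → ℂ, IsWeilTest f → tsupport f ⊆ Icc (-Real.log 2) (Real.log 2) →
          HasSum (fun n => weilMellin f (1 / 2 + ((x n + δ n : ℝ) : ℂ) * I))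
            (weilFunctional f)

/-! ## The registered stubs (signatures spelled out verbatim; `sorry` lives only here) -/

/-- **stub_base — the França–LeClair base configuration (M).** The symmetric Gram-type half
lattice `FL = {t : 7 ≤ |t| ∧ cos θ(t) = 0}` (positive points: the increasing-branch solutions of
`θ(xₙ) = (n - 3/2)π`, França–LeClair arXiv:1502.06003 eq. (18) with `arg ζ` dropped; the cut
`|t| ≥ 7` removes the decreasing-branch pair `±0.8195`) is countably infinite — enumerated
injectively by `ℕ` — and LOG-SPARSE: at most `C(1+|T|)^N` (indeed `O(1 + log(1+|T|))`) of its
points lie in any unit cell `[T-1, T+1]`. Tools in tree: `strictMonoOn_riemannSiegelTheta_Ici_seven`,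
`riemannSiegelThetaDeriv_pos_of_seven_le`, `riemannSiegelTheta_neg_holds` (oddness),
`hasDerivAt_riemannSiegelTheta_holds`, `continuous_riemannSiegelTheta`,
`abs_riemannSiegelThetaDeriv_sub_log_le`, `tendsto_riemannSiegelTheta_atTop` (`θ → ∞`). Proof:
`θ` is continuous, odd, strictly increasing on `[7, ∞)` and unbounded, so `FL ∩ [7,∞)` is
`θ⁻¹(π/2 + πℤ) ∩ [7,∞)`, countable (one point per level) and infinite (IVT), hence `≃ ℕ`; the
count profile is the mean value theorem with `θ' ≤ ½ log(u/2π) + 1` on `[7, ∞)` (consecutive points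
are `π` apart in `θ`). -/
theorem stub_base :
    ∃ x : ℕ → ℝ, Function.Injective x ∧
      Set.range x = {t : ℝ | 7 ≤ |t| ∧ Real.cos (Literature.NumberTheory.LFunctions.riemannSiegelTheta t) = 0} ∧
      ∃ (C : ℝ) (N : ℕ), ∀ (T : ℝ) (s : Finset ℕ), (∀ n ∈ s, |x n - T| ≤ 1) →
        (s.card : ℝ) ≤ C * (1 + |T|) ^ N :=
  Summit.RiemannHypothesis.RiemannHypothesis.Theorems.SpectralTraceWindowTraceArch.stub_base

/-- **stub_acuteAngle — the acute-angle form of Brouwer's fixed-point theorem (S; the tree has it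
on finite-dimensional inner product spaces).** A continuous self-map `f` of `ℝ^m` with
`⟨c, f c⟩ ≥ 0` on the sphere `‖c‖ = R` has a zero in the closed ball `‖c‖ ≤ R`
(Bondarenko–Radchenko–Viazovska, Ann. Math. 178 (2013), Lemma 1; Temam Ch. II Lemma 1.4).
Proof: transport `Literature.Topology.Euclidean.Brouwer.exists_zero_of_inner_nonneg_on_sphere`
(BrouwerAcuteAngle.lean) along `EuclideanSpace ℝ (Fin m) ≃ (Fin m → ℝ)` (`WithLp.equiv`,
`EuclideanSpace.norm_eq`, `real_inner_eq`/`PiLp.inner_apply`). -/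
theorem stub_acuteAngle :
    ∀ (m : ℕ) (R : ℝ), 0 < R → ∀ f : (Fin m → ℝ) → (Fin m → ℝ), Continuous f →
      (∀ c : Fin m → ℝ, ∑ i, c i ^ 2 = R ^ 2 → 0 ≤ ∑ i, c i * f c i) →
      ∃ c : Fin m → ℝ, ∑ i, c i ^ 2 ≤ R ^ 2 ∧ f c = 0 :=
  Summit.RiemannHypothesis.RiemannHypothesis.Theorems.SpectralTraceWindowTraceArch.stub_acuteAngle

/-- **stub_design — bounded-displacement designs of `FL` for every finite list of window tests
(XL; HARDEST; load-bearing; held by the lead).** Given the acute-angle lemma: for ANY injective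
enumeration `x` of `FL` there is ONE budget `D` such that for every sequence of window Weil tests `g`
and every `m` some displacement `δ` with `|δ n| ≤ D` makes the unit-atomic family `n ↦ x n + δ n`
reproduce `W(g j)` EXACTLY (as an unconditional `HasSum` over `ℕ`) for all `j < m`. Engine (card
`defect-compactness-design`): with `G_c = Σⱼ cⱼ gⱼ` push each atom uphill along `Ĝ_c` inside its
budget, `F(c) := (Σₙ ĝⱼ(xₙ + δₙ(c)) - W(gⱼ))ⱼ`, and show `⟨c, F c⟩ > 0` on a large sphere — the gain
`Σₙ [Ĝ_c(xₙ+δₙ) - Ĝ_c(xₙ)]` must beat the base defect `Σₙ Ĝ_c(xₙ) - W(G_c)` (smooth, non-stationary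
Poisson aliasing of the chirped lattice; `c_δ = 0` for `FL`); then `stub_acuteAngle` in dimension
`2m` (real and imaginary parts). RH-implied as stated (matching `±xₙ ↦ ±γₙ` is a bounded
displacement by `S(T) = O(log T)`), hence irrefutable short of `¬RH`. Constraint from Disproof §4:
every exact design has `|x n + δ n| ≥ 11`. -/
theorem stub_design :
    (∀ (m : ℕ) (R : ℝ), 0 < R → ∀ f : (Fin m → ℝ) → (Fin m → ℝ), Continuous f →
      (∀ c : Fin m → ℝ, ∑ i, c i ^ 2 = R ^ 2 → 0 ≤ ∑ i, c i * f c i) →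
      ∃ c : Fin m → ℝ, ∑ i, c i ^ 2 ≤ R ^ 2 ∧ f c = 0) →
    ∀ x : ℕ → ℝ, Function.Injective x →
      Set.range x = {t : ℝ | 7 ≤ |t| ∧ Real.cos (Literature.NumberTheory.LFunctions.riemannSiegelTheta t) = 0} →
      ∃ D : ℝ, ∀ (g : ℕ → ℝ → ℂ) (m : ℕ),
        (∀ j, Literature.NumberTheory.LFunctions.IsWeilTest (g j) ∧ tsupport (g j) ⊆ Set.Icc (-Real.log 2) (Real.log 2)) →
        ∃ δ : ℕ → ℝ, (∀ n, |δ n| ≤ D) ∧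
          ∀ j < m, HasSum (fun n => Literature.NumberTheory.LFunctions.weilMellin (g j) (1 / 2 + ((x n + δ n : ℝ) : ℂ) * Complex.I))
            (Literature.NumberTheory.LFunctions.weilFunctional (g j)) := by
  sorry

/-- **stub_domination — summable domination of `ĝ` along a poly-profile configuration (M; shared
by `stub_compactness` and `stub_extensionOfDense`).** For a configuration `x` with
`#{n : |x n - T| ≤ 1} ≤ C(1+|T|)^N` and a budget `D` there are `K` and `k` (one may take
`k = N + 2`) such that for every Weil test `f` the values `ĝ(½ + i(xₙ + v))`, `|v| ≤ D`, are bounded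
by a summable `bₙ` with `Σ bₙ ≤ K (∫‖f‖ + ∫‖f^{(k)}‖)`. Proof: on the line `Re s = ½`,
`‖f̂(½+iu)‖ ≤ ∫‖f‖` and, after `k` integrations by parts (`weilMellin_deriv`, `IsWeilTest.deriv`,
`iteratedDeriv_succ`), `|u|^k ‖f̂(½+iu)‖ ≤ ∫‖f^{(k)}‖`; hence
`‖f̂(½+iu)‖ ≤ 2^k (∫‖f‖ + ∫‖f^{(k)}‖)/(1+|u|)^k` and, for `|v| ≤ D`, `1+|xₙ| ≤ (1+|D|)(1+|xₙ+v|)`;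
finally `Σₙ (1+|xₙ|)^{-k} < ∞` for `k ≥ N+2` by sorting `n` into the cells `⌊xₙ⌋ = m ∈ ℤ` (each holds
`≤ C(2+|m|)^N` indices by the profile at `T = m + 1/2`) and `Σ_m (2+|m|)^N (|m|)₊^{-k} < ∞`.
Degenerate data (`D < 0`: no `v`; `C < 0`: profile contradictory at `s = ∅`) are harmless. -/
theorem stub_domination :
    ∀ (x : ℕ → ℝ) (C D : ℝ) (N : ℕ),
      (∀ (T : ℝ) (s : Finset ℕ), (∀ n ∈ s, |x n - T| ≤ 1) → (s.card : ℝ) ≤ C * (1 + |T|) ^ N) →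
      ∃ (K : ℝ) (k : ℕ), ∀ f : ℝ → ℂ, Literature.NumberTheory.LFunctions.IsWeilTest f →
        ∃ b : ℕ → ℝ, Summable b ∧
          (∀ (n : ℕ) (v : ℝ), |v| ≤ D →
            ‖Literature.NumberTheory.LFunctions.weilMellin f (1 / 2 + ((x n + v : ℝ) : ℂ) * Complex.I)‖ ≤ b n) ∧
          ∑' n, b n ≤ K * ((∫ t, ‖f t‖) + ∫ t, ‖iteratedDeriv k f t‖) :=
  Summit.RiemannHypothesis.RiemannHypothesis.Theorems.SpectralTraceWindowTraceArch.stub_domination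

/-- **stub_compactness — Lemma DC: exactness survives the limit of designs (M), given
domination.** Let `x` be a configuration with a polynomial local count profile, `gⱼ` Weil tests, and
`δ k` (`k ∈ ℕ`) displacements with the common budget `D` such that, for each `j`, the family
`n ↦ x n + δ k n` reproduces `W(gⱼ)` exactly for all large `k`. Then ONE displacement `δ'` within the
same budget reproduces every `W(gⱼ)`. Proof: the cube `{δ | ∀ n, δ n ∈ [-D, D]}` is compact in the
product topology (`isCompact_univ_pi`) and `ℕ → ℝ` is first countable / Polish, so a subsequence
`δ (φ k)` converges pointwise to some `δ'` in the cube (`IsCompact.isSeqCompact` /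
`IsCompact.tendsto_subseq`); for fixed `j`, `stub_domination` gives a summable `b` dominating
`‖ĝⱼ(½ + i(xₙ + v))‖` for all `|v| ≤ D`; Tannery's theorem (`tendsto_tsum_of_dominated_convergence`)
and continuity of `u ↦ ĝⱼ(½+iu)` (`continuous` from `hasDerivAt_weilMellin`) give
`Σₙ ĝⱼ(½ + i(xₙ + δ'ₙ)) = lim_k W(gⱼ) = W(gⱼ)`; the limit family is absolutely summable (dominated by
`b`), hence `HasSum`. If `D < 0` the hypotheses are contradictory (`|δ 0 0| ≤ D`). -/
theorem stub_compactness :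
    (∀ (x : ℕ → ℝ) (C D : ℝ) (N : ℕ),
      (∀ (T : ℝ) (s : Finset ℕ), (∀ n ∈ s, |x n - T| ≤ 1) → (s.card : ℝ) ≤ C * (1 + |T|) ^ N) →
      ∃ (K : ℝ) (k : ℕ), ∀ f : ℝ → ℂ, Literature.NumberTheory.LFunctions.IsWeilTest f →
        ∃ b : ℕ → ℝ, Summable b ∧
          (∀ (n : ℕ) (v : ℝ), |v| ≤ D →
            ‖Literature.NumberTheory.LFunctions.weilMellin f (1 / 2 + ((x n + v : ℝ) : ℂ) * Complex.I)‖ ≤ b n) ∧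
          ∑' n, b n ≤ K * ((∫ t, ‖f t‖) + ∫ t, ‖iteratedDeriv k f t‖)) →
    ∀ (x : ℕ → ℝ) (C D : ℝ) (N : ℕ) (g : ℕ → ℝ → ℂ) (δ : ℕ → ℕ → ℝ),
      (∀ (T : ℝ) (s : Finset ℕ), (∀ n ∈ s, |x n - T| ≤ 1) → (s.card : ℝ) ≤ C * (1 + |T|) ^ N) →
      (∀ j, Literature.NumberTheory.LFunctions.IsWeilTest (g j)) → (∀ k n, |δ k n| ≤ D) →
      (∀ j, ∀ᶠ k in Filter.atTop,
        HasSum (fun n => Literature.NumberTheory.LFunctions.weilMellin (g j) (1 / 2 + ((x n + δ k n : ℝ) : ℂ) * Complex.I))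
          (Literature.NumberTheory.LFunctions.weilFunctional (g j))) →
      ∃ δ' : ℕ → ℝ, (∀ n, |δ' n| ≤ D) ∧
        ∀ j, HasSum (fun n => Literature.NumberTheory.LFunctions.weilMellin (g j) (1 / 2 + ((x n + δ' n : ℝ) : ℂ) * Complex.I))
          (Literature.NumberTheory.LFunctions.weilFunctional (g j)) :=
  Summit.RiemannHypothesis.RiemannHypothesis.Theorems.SpectralTraceWindowTraceArch.stub_compactness

/-- **stub_denseFamily — a countable family of window tests dense in every `C^k` sup-seminorm
(L).** There is a sequence `gⱼ` of Weil tests supported in the closed window `K = [-log 2, log 2]`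
such that for every Weil test `f` supported in `K`, every `k` and every `ε > 0` some `gⱼ` has
`sup_t ‖(f - gⱼ)^{(i)}(t)‖ ≤ ε` for all `i ≤ k`. Proof (all elementary, but long): (1) FLATNESS — a
smooth `f` with `tsupport f ⊆ K` has all derivatives `0` outside the open window, so by Taylor
`‖f^{(i)}(t)‖ ≤ C_{f,r} · dist(t, Kᶜ)^r` for every `r`; (2) CUTOFFS — fix smooth `χ_m : ℝ → [0,1]`
supported in `K`, equal to `1` on `[-log 2 + 2/m, log 2 - 2/m]`, with `‖χ_m^{(i)}‖_∞ ≤ c_i m^i`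
(`ContDiffBump` / `Real.smoothTransition` rescaled); by (1) and Leibniz, `‖(f - χ_m f)^{(i)}‖_∞ → 0`
as `m → ∞` for each `i ≤ k`; (3) POLYNOMIALS — by Weierstrass (`polynomialFunctions.topologicalClosure`,
`ContinuousMap` on `K`) approximate `f^{(k)}` uniformly on `K` by a polynomial and integrate `k`
times from `-log 2` to get a polynomial `P` with `‖(f - P)^{(i)}‖_{∞,K} ≤ (2 log 2)^{k-i} ε` for
`i ≤ k`; perturb to rational (e.g. `ℚ + ℚ i`) coefficients; (4) `‖(χ_m (f - P))^{(i)}‖_∞ ≤ C_m Σ_{l≤i}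
‖(f-P)^{(l)}‖_{∞,K}`. The family `{χ_m · P : m ∈ ℕ, P ∈ (ℚ[i])[t]}` is countable; enumerate it by `ℕ`
(`Set.Countable`, `Encodable`/`Denumerable` or an explicit surjection from `ℕ`). -/
theorem stub_denseFamily :
    ∃ g : ℕ → ℝ → ℂ,
      (∀ j, Literature.NumberTheory.LFunctions.IsWeilTest (g j) ∧ tsupport (g j) ⊆ Set.Icc (-Real.log 2) (Real.log 2)) ∧
      ∀ f : ℝ → ℂ, Literature.NumberTheory.LFunctions.IsWeilTest f → tsupport f ⊆ Set.Icc (-Real.log 2) (Real.log 2) →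
        ∀ (k : ℕ) (ε : ℝ), 0 < ε → ∃ j, ∀ i ≤ k, ∀ t : ℝ, ‖iteratedDeriv i (f - g j) t‖ ≤ ε :=
  Summit.RiemannHypothesis.RiemannHypothesis.Theorems.SpectralTraceWindowTraceArch.stub_denseFamily

/-- **stub_extensionOfDense — continuity of both sides: exactness on a dense family is exactness on
the window (M), given domination.** Let `gⱼ` be dense as in `stub_denseFamily`, `x` poly-profile,
`|δ n| ≤ D`, and suppose `n ↦ x n + δ n` reproduces `W(gⱼ)` for every `j`. Then it reproduces `W(f)`
for every Weil test `f` supported in `K`. Proof: put `h = f - gⱼ` (a Weil test supported in `K`;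
`IsWeilTest` is closed under subtraction: `ContDiff.sub`, `HasCompactSupport.sub`). SPECTRAL SIDE: by
`stub_domination` (with `v = δ n`) the family `n ↦ ĥ(½ + i(xₙ + δₙ))` is absolutely summable with
`Σ ‖·‖ ≤ K (∫‖h‖ + ∫‖h^{(k)}‖) ≤ K · 2 log 2 · (sup‖h‖ + sup‖h^{(k)}‖)`, and `ĥ = f̂ - ĝⱼ`
(`weilMellin_sub`, WeilWindowSuzukiContinuityProofs / `weilMellin_add`, WeilMellinBounds). WEIL SIDE:
`W(f) - W(gⱼ) = W(h)` (`weilFunctional_add`, WeilWindowSimpleEven.lean) and on the closed window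
`W(h) = ĥ(0) + ĥ(1) + (1/2π)∫ ĥ(½+it) Re ψ(¼+it/2) dt - h(0) log π` (the prime term vanishes:
`weilPrimeTerm_eq_zero_of_tsupport_subset`, WeilArchimedeanPositivityProofs), so
`|W(h)| ≤ 2√2 ∫‖h‖ + (1/2π) ∫ (5 + log(1+|t|)) · 4(∫‖h‖ + ∫‖h''‖)/(1+|t|)² dt + log π ‖h 0‖`
(`norm_weilMellin_le_weilL1`, `weilMellin_deriv_deriv`, `Negative.LocalWeylTools.reDigammaQuarter_le_log`
and `Re ψ(¼+it/2) ≥ ψ(¼) > -5`, `integrable_weilArchIntegrand`). Given `ε`, density with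
`k' = max k 2` makes both differences `≤ const · ε`; so `Σₙ f̂(½+i(xₙ+δₙ)) = W(f)`, and the sum is a
`HasSum` because it is absolutely convergent (domination of `f` itself). -/
theorem stub_extensionOfDense :
    (∀ (x : ℕ → ℝ) (C D : ℝ) (N : ℕ),
      (∀ (T : ℝ) (s : Finset ℕ), (∀ n ∈ s, |x n - T| ≤ 1) → (s.card : ℝ) ≤ C * (1 + |T|) ^ N) →
      ∃ (K : ℝ) (k : ℕ), ∀ f : ℝ → ℂ, Literature.NumberTheory.LFunctions.IsWeilTest f →
        ∃ b : ℕ → ℝ, Summable b ∧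
          (∀ (n : ℕ) (v : ℝ), |v| ≤ D →
            ‖Literature.NumberTheory.LFunctions.weilMellin f (1 / 2 + ((x n + v : ℝ) : ℂ) * Complex.I)‖ ≤ b n) ∧
          ∑' n, b n ≤ K * ((∫ t, ‖f t‖) + ∫ t, ‖iteratedDeriv k f t‖)) →
    ∀ g : ℕ → ℝ → ℂ,
      ((∀ j, Literature.NumberTheory.LFunctions.IsWeilTest (g j) ∧ tsupport (g j) ⊆ Set.Icc (-Real.log 2) (Real.log 2)) ∧
        ∀ f : ℝ → ℂ, Literature.NumberTheory.LFunctions.IsWeilTest f → tsupport f ⊆ Set.Icc (-Real.log 2) (Real.log 2) →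
          ∀ (k : ℕ) (ε : ℝ), 0 < ε → ∃ j, ∀ i ≤ k, ∀ t : ℝ, ‖iteratedDeriv i (f - g j) t‖ ≤ ε) →
      ∀ (x : ℕ → ℝ) (C D : ℝ) (N : ℕ) (δ : ℕ → ℝ),
        (∀ (T : ℝ) (s : Finset ℕ), (∀ n ∈ s, |x n - T| ≤ 1) → (s.card : ℝ) ≤ C * (1 + |T|) ^ N) →
        (∀ n, |δ n| ≤ D) →
        (∀ j, HasSum (fun n => Literature.NumberTheory.LFunctions.weilMellin (g j) (1 / 2 + ((x n + δ n : ℝ) : ℂ) * Complex.I))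
          (Literature.NumberTheory.LFunctions.weilFunctional (g j))) →
        ∀ f : ℝ → ℂ, Literature.NumberTheory.LFunctions.IsWeilTest f → tsupport f ⊆ Set.Icc (-Real.log 2) (Real.log 2) →
          HasSum (fun n => Literature.NumberTheory.LFunctions.weilMellin f (1 / 2 + ((x n + δ n : ℝ) : ℂ) * Complex.I))
            (Literature.NumberTheory.LFunctions.weilFunctional f) :=
  Summit.RiemannHypothesis.RiemannHypothesis.Theorems.SpectralTraceWindowTraceArch.stub_extensionOfDense

/-! ## Consistency: each named statement IS its registered stub (definitionally) -/

theorem baseStatement_holds : BaseStatement := stub_base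
theorem acuteAngleStatement_holds : AcuteAngleStatement := stub_acuteAngle
theorem designStatement_holds : DesignStatement := stub_design
theorem dominationStatement_holds : DominationStatement := stub_domination
theorem compactnessStatement_holds : CompactnessStatement := stub_compactness
theorem denseFamilyStatement_holds : DenseFamilyStatement := stub_denseFamily
theorem extensionOfDenseStatement_holds : ExtensionOfDenseStatement := stub_extensionOfDense

/-! ## Name-keyed aliases of the seven statements (the hypotheses of the composition) -/
namespace Registered

/-- Alias of `BaseStatement` keyed by the registered stub name. -/
abbrev stub_base : Prop := BaseStatement
/-- Alias of `AcuteAngleStatement` keyed by the registered stub name. -/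
abbrev stub_acuteAngle : Prop := AcuteAngleStatement
/-- Alias of `DesignStatement` keyed by the registered stub name. -/
abbrev stub_design : Prop := DesignStatement
/-- Alias of `DominationStatement` keyed by the registered stub name. -/
abbrev stub_domination : Prop := DominationStatement
/-- Alias of `CompactnessStatement` keyed by the registered stub name. -/
abbrev stub_compactness : Prop := CompactnessStatement
/-- Alias of `DenseFamilyStatement` keyed by the registered stub name. -/
abbrev stub_denseFamily : Prop := DenseFamilyStatement
/-- Alias of `ExtensionOfDenseStatement` keyed by the registered stub name. -/
abbrev stub_extensionOfDense : Prop := ExtensionOfDenseStatement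

end Registered

/-! ## Structure of witnesses (lead, wave 2): every witness is a bounded displacement of `FL`

The converse direction `WindowTraceArch → DesignStatement`. A witness `γ : ι → ℝ` of the crux has the
two-sided counting law `#{i : γ i ∈ [0,T]} = θ(T)/π + O(log T)` (Beurling–Selberg: the window identity
extends from smooth tests to the continuous, band-limited tests whose transforms are Selberg's
majorant/minorant `F±` of `𝟙_{[0,T]}` with bandwidth `Δ = (log 2)/2π`, and
`W(g±) = ∫ F± θ'/π + O(1)`), hence, after sorting, it is a bounded displacement of the França–LeClair
lattice (`N_FL(T) = θ(T)/π + O(1)` and the gaps of `FL` are `π/θ' ≍ 2π/log T`). Six registered stubs: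
five for workers, the assembly for the lead. -/

/-- The crux body for a fixed family (documentation constant; the stubs inline it). -/
def IsWitness {ι : Type} (γ : ι → ℝ) : Prop :=
  ∀ g : ℝ → ℂ, IsWeilTest g → tsupport g ⊆ Icc (-Real.log 2) (Real.log 2) →
    HasSum (fun i => weilMellin g (1 / 2 + (γ i : ℂ) * I)) (weilFunctional g)

/-- **stub_bandlimitedTest — the window identity for continuous band-limited tests (L).** If `γ` is a
witness then the identity `Σᵢ ĝ(½+iγᵢ) = W(g)` holds for every CONTINUOUS `g` supported in the closed
window whose transform decays like `M/(1+u²)` on the critical line (not only for smooth `g`). Proof: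
`g_k := (g(λ_k ·)) ⋆ φ_k` (dilate by `λ_k ↓ 1`, then mollify by a bump of radius `< log 2 − (log 2)/λ_k`)
are Weil tests in the window; `ĝ_k(½+iu) = λ_k⁻¹ ĝ(½+iu/λ_k) φ̂_k(u)` (`weilMellin_weilConv_holds`, a
change of variables), so `|ĝ_k(½+iu)| ≤ 4M/(1+u²)` and `ĝ_k → ĝ` pointwise; `Σᵢ (1+γᵢ²)⁻¹ < ∞` for a
witness (local Weyl law `card_near_le_log_of_windowTraceArch_witness`), so Tannery gives
`Σᵢ ĝ_k(½+iγᵢ) → Σᵢ ĝ(½+iγᵢ)`; on the Weil side `W(g_k) = ĝ_k(0) + ĝ_k(1) + (1/2π)∫ ĝ_k Re ψ − g_k(0) log π`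
(no prime term in the window) converges to the same expression for `g` (uniform convergence
`g_k → g` on the window; dominated convergence with `4M(C_ψ + log(1+|u|))/(1+u²)`), which IS
`weilFunctional g` (`weilArchIntegral g` is a genuine Bochner integral by the decay hypothesis). -/
theorem stub_bandlimitedTest :
    ∀ (ι : Type) (γ : ι → ℝ),
      (∀ g : ℝ → ℂ, Literature.NumberTheory.LFunctions.IsWeilTest g →
        tsupport g ⊆ Set.Icc (-Real.log 2) (Real.log 2) →
        HasSum (fun i => Literature.NumberTheory.LFunctions.weilMellin g (1 / 2 + (γ i : ℂ) * Complex.I))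
          (Literature.NumberTheory.LFunctions.weilFunctional g)) →
      ∀ (g : ℝ → ℂ) (M : ℝ), Continuous g → tsupport g ⊆ Set.Icc (-Real.log 2) (Real.log 2) →
        (∀ u : ℝ, ‖Literature.NumberTheory.LFunctions.weilMellin g (1 / 2 + (u : ℂ) * Complex.I)‖ ≤ M / (1 + u ^ 2)) →
        HasSum (fun i => Literature.NumberTheory.LFunctions.weilMellin g (1 / 2 + (γ i : ℂ) * Complex.I))
          (Literature.NumberTheory.LFunctions.weilFunctional g) :=
  Summit.RiemannHypothesis.RiemannHypothesis.Theorems.SpectralTraceWindowTraceArch.stub_bandlimitedTest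

/-- **stub_selbergTests — the band-limited window tests with transforms `F±` (L).** For `T ≥ 0` there
are continuous `g±` supported in the closed window with `ĝ±(½+iz·(−i)…)`: precisely
`weilMellin g± (½ + z I) = F±(z)` for ALL complex `z`, where `F± = selbergMajorant/Minorant Δ 0 T`,
`Δ = (log 2)/2π` (so on the critical line `ĝ±(½+iu) = F±(u)`, and the polar values are
`ĝ±(0) = F±(i/2)`, `ĝ±(1) = F±(−i/2)`), and `g±(0) = (T ± 1/Δ)/2π`. Construction:
`g±(x) := (1/2π) 𝓕(F±|_ℝ)(x/2π)` (Mathlib `𝓕`, kernel `e^{−2πixξ}`); support from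
`fourier_selbergMajorant_eq_zero` (`𝓕F± = 0` off `[−Δ, Δ]`, and `2πΔ = log 2`), continuity of `𝓕` of an
integrable function, `∫ g±(x) e^{iux} dx = 𝓕⁻¹𝓕F±(u) = F±(u)` by Fourier inversion
(`Continuous.fourier_inversion`: `F±` continuous integrable with integrable transform), extension to
complex `z` by the identity theorem (both sides entire), `g±(0) = (1/2π)𝓕F±(0)` =
`fourier_selbergMajorant_zero`. -/
theorem stub_selbergTests :
    ∀ T : ℝ, 0 ≤ T → ∃ gp gm : ℝ → ℂ, Continuous gp ∧ Continuous gm ∧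
      tsupport gp ⊆ Set.Icc (-Real.log 2) (Real.log 2) ∧ tsupport gm ⊆ Set.Icc (-Real.log 2) (Real.log 2) ∧
      (∀ z : ℂ, Literature.NumberTheory.LFunctions.weilMellin gp (1 / 2 + z * Complex.I) =
        Literature.Analysis.Fourier.selbergMajorant (Real.log 2 / (2 * Real.pi)) 0 T z) ∧
      (∀ z : ℂ, Literature.NumberTheory.LFunctions.weilMellin gm (1 / 2 + z * Complex.I) =
        Literature.Analysis.Fourier.selbergMinorant (Real.log 2 / (2 * Real.pi)) 0 T z) ∧
      gp 0 = (((T + 2 * Real.pi / Real.log 2) / (2 * Real.pi) : ℝ) : ℂ) ∧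
      gm 0 = (((T - 2 * Real.pi / Real.log 2) / (2 * Real.pi) : ℝ) : ℂ) :=
  Summit.RiemannHypothesis.RiemannHypothesis.Theorems.SpectralTraceWindowTraceArch.stub_selbergTests

/-- **stub_countingLaw — the two-sided counting law of a witness (L).** Given the two previous stubs:
for every witness `γ` there is `C` with `#{i : γ i ∈ [0, T]} = θ(T)/π + E`, `|E| ≤ C(1 + log(1+T))`
for all `T ≥ 0` (the set is finite by the local Weyl law `finite_abs_le_of_windowTraceArch_witness`).
Proof: apply `stub_bandlimitedTest` to `g±` of `stub_selbergTests` (decay `|F±(u)| ≤ K((1+u²)⁻¹ +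
(1+(u−T)²)⁻¹) ≤ 3K(1+T²)/(1+u²)`, `exists_norm_selbergMajorant_le`); the sums `Σᵢ F±(γᵢ)` are real,
`F₋ ≤ 𝟙_{[0,T]} ≤ F₊` pointwise (`selbergMinorantReal_le_indicator_Icc`, `indicator_le_selbergMajorantReal`,
`F₊ ≥ 0`) so `Σ F₋(γᵢ) ≤ # ≤ Σ F₊(γᵢ)` (`hasSum_le`, finite support of the indicator family); and
`W(g±) = F±(i/2) + F±(−i/2) + (1/2π)∫ F±(u) Re ψ(¼+iu/2) du − g±(0) log π` with
`θ(T)/π = ∫₀ᵀ θ'(u)/π du`, `θ'(u) = Re ψ(¼+iu/2)/2 − (log π)/2` (`riemannSiegelThetaDeriv`, FTC), so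
`W(g±) − θ(T)/π = O(1) + (1/2π)∫ (F± − 𝟙_{[0,T]}) Re ψ`, bounded by
`∫ K((1+u²)⁻¹ + (1+(u−T)²)⁻¹)(C_ψ + log(1+|u|)) ≤ K'(1 + log(1+T))`
(`exists_norm_digamma_vertical_le`, `log(1+|u|) ≤ log(1+T) + log(1+|u−T|)`); `|F±(±i/2)| ≤ 3e^{2π}e^{πΔ}`
(`norm_selbergMajorant_le`). -/
theorem stub_countingLaw :
    (∀ (ι : Type) (γ : ι → ℝ),
      (∀ g : ℝ → ℂ, Literature.NumberTheory.LFunctions.IsWeilTest g →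
        tsupport g ⊆ Set.Icc (-Real.log 2) (Real.log 2) →
        HasSum (fun i => Literature.NumberTheory.LFunctions.weilMellin g (1 / 2 + (γ i : ℂ) * Complex.I))
          (Literature.NumberTheory.LFunctions.weilFunctional g)) →
      ∀ (g : ℝ → ℂ) (M : ℝ), Continuous g → tsupport g ⊆ Set.Icc (-Real.log 2) (Real.log 2) →
        (∀ u : ℝ, ‖Literature.NumberTheory.LFunctions.weilMellin g (1 / 2 + (u : ℂ) * Complex.I)‖ ≤ M / (1 + u ^ 2)) →
        HasSum (fun i => Literature.NumberTheory.LFunctions.weilMellin g (1 / 2 + (γ i : ℂ) * Complex.I))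
          (Literature.NumberTheory.LFunctions.weilFunctional g)) →
    (∀ T : ℝ, 0 ≤ T → ∃ gp gm : ℝ → ℂ, Continuous gp ∧ Continuous gm ∧
      tsupport gp ⊆ Set.Icc (-Real.log 2) (Real.log 2) ∧ tsupport gm ⊆ Set.Icc (-Real.log 2) (Real.log 2) ∧
      (∀ z : ℂ, Literature.NumberTheory.LFunctions.weilMellin gp (1 / 2 + z * Complex.I) =
        Literature.Analysis.Fourier.selbergMajorant (Real.log 2 / (2 * Real.pi)) 0 T z) ∧
      (∀ z : ℂ, Literature.NumberTheory.LFunctions.weilMellin gm (1 / 2 + z * Complex.I) =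
        Literature.Analysis.Fourier.selbergMinorant (Real.log 2 / (2 * Real.pi)) 0 T z) ∧
      gp 0 = (((T + 2 * Real.pi / Real.log 2) / (2 * Real.pi) : ℝ) : ℂ) ∧
      gm 0 = (((T - 2 * Real.pi / Real.log 2) / (2 * Real.pi) : ℝ) : ℂ)) →
    ∀ (ι : Type) (γ : ι → ℝ),
      (∀ g : ℝ → ℂ, Literature.NumberTheory.LFunctions.IsWeilTest g →
        tsupport g ⊆ Set.Icc (-Real.log 2) (Real.log 2) →
        HasSum (fun i => Literature.NumberTheory.LFunctions.weilMellin g (1 / 2 + (γ i : ℂ) * Complex.I))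
          (Literature.NumberTheory.LFunctions.weilFunctional g)) →
      ∃ C : ℝ, ∀ T : ℝ, 0 ≤ T →
        {i : ι | γ i ∈ Set.Icc 0 T}.Finite ∧
        |(({i : ι | γ i ∈ Set.Icc 0 T}.ncard : ℕ) : ℝ) -
            Literature.NumberTheory.LFunctions.riemannSiegelTheta T / Real.pi| ≤ C * (1 + Real.log (1 + T)) :=
  Summit.RiemannHypothesis.RiemannHypothesis.Theorems.SpectralTraceWindowTraceArch.stub_countingLaw

/-- **stub_sortedEnumeration — sorting a locally finite family (M).** A family `γ : ι → ℝ` all of whose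
sets `{i : |γ i| ≤ R}` are finite and which has infinitely many indices with `γ i ≥ 0` admits an
injective `e : ℕ → ι` enumerating exactly those indices in non-decreasing order of `γ`. Proof: greedy
recursion — at each step pick an unused non-negative index minimising `γ` (the candidates below any
level form a finite set), or: the non-negative indices form a countably infinite set on which
`i ↦ (γ i, rank within the finite fibre)` is a well-order of type `ω`. -/
theorem stub_sortedEnumeration :
    ∀ (ι : Type) (γ : ι → ℝ), (∀ R : ℝ, {i : ι | |γ i| ≤ R}.Finite) → {i : ι | 0 ≤ γ i}.Infinite →
      ∃ e : ℕ → ι, Function.Injective e ∧ Set.range e = {i : ι | 0 ≤ γ i} ∧ Monotone (fun n => γ (e n)) :=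
  Summit.RiemannHypothesis.RiemannHypothesis.Theorems.SpectralTraceWindowTraceArch.stub_sortedEnumeration

/-- **stub_displacementBound — from counting to displacement (L).** Let `a : ℕ → ℝ` be non-decreasing
and non-negative with the counting law `#{n : a n ≤ T} = θ(T)/π + O(log(1+T))` (`T ≥ 0`), and let
`p : ℕ → ℝ` be the positive França–LeClair points in increasing order: `p` strictly increasing, `p n ≥ 7`,
`θ(p n) = (n − ½)π` (so `p 0 = 14.52…`, and `#{n : p n ≤ T} = ⌊θ(T)/π + ½⌋ + 1`, i.e. `θ(T)/π + O(1)`).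
Then `sup_n |a n − p n| < ∞`. Proof: with `E(T) = C(1+log(1+T)) + 2 ≥ |N_a(T) − N_p(T)|`,
monotonicity gives `p_{n−k} ≤ a n ≤ p_{n+k}` for `k = ⌈E(a n)⌉ + 3` (compare the two counting
functions at `T = a n` and at `T = p_{n+k}`); consecutive gaps of `p` are `π/θ'(ξ) ≤ π/θ'(p_m)`
(`θ'` = `riemannSiegelThetaDeriv` is increasing on `[7,∞)`: `Re ψ(¼+iu/2)` is, and positive there,
`riemannSiegelThetaDeriv_pos_of_seven_le`) and `θ'(u) ≥ ½ log(u/2π) − c/u`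
(`abs_riemannSiegelThetaDeriv_sub_log_le`), while `k = O(log a n) = O(log n)` and `log p_{n−k} ≥
log n − log log n − O(1)` (`θ(t) ≤ (t/2) log t`, `abs_riemannSiegelTheta_sub_stirling_le`): the
product `k · π/θ'(p_{n−k})` stays bounded; small `n` are finitely many. -/
theorem stub_displacementBound :
    ∀ (a p : ℕ → ℝ) (C : ℝ), Monotone a → (∀ n, 0 ≤ a n) → StrictMono p → (∀ n, 7 ≤ p n) →
      (∀ n : ℕ, Literature.NumberTheory.LFunctions.riemannSiegelTheta (p n) = ((n : ℝ) - 1 / 2) * Real.pi) →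
      (∀ T : ℝ, 0 ≤ T → {n : ℕ | a n ≤ T}.Finite ∧
        |(({n : ℕ | a n ≤ T}.ncard : ℕ) : ℝ) -
            Literature.NumberTheory.LFunctions.riemannSiegelTheta T / Real.pi| ≤ C * (1 + Real.log (1 + T))) →
      ∃ D : ℝ, ∀ n, |a n - p n| ≤ D :=
  Summit.RiemannHypothesis.RiemannHypothesis.Theorems.SpectralTraceWindowTraceArch.stub_displacementBound

/-- **stub_structureAssembly — every witness is a bounded displacement of `FL` (L; lead).** Given the
five previous stubs: if `γ` is a witness of the crux then for every injective enumeration `x` of `FL`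
there are `D` and `δ` with `|δ n| ≤ D` such that `n ↦ x n + δ n` is a re-indexing of `γ` (hence again a
witness). Proof: the reflected family `−γ` is also a witness (`W` and the window are even); sort the
indices with `γ i ≥ 0` and with `γ i < 0` (stub_sortedEnumeration; both index sets infinite by the
counting law, locally finite by the local Weyl law); the positive `FL` points sorted are the `p n`
(`θ(p n) = (n−½)π`, from `strictMonoOn_riemannSiegelTheta_Ici_seven` + IVT), the negative ones are
`−p n` (`θ` odd); stub_countingLaw (for `γ` and for `−γ`) + stub_displacementBound give
`|γ(e⁺ n) − p n| ≤ D`, `|γ(e⁻ n) + p n| ≤ D`; transport along the bijection `ℕ ≃ ι` induced by `x`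
(`Equiv.hasSum_iff`). -/
theorem stub_structureAssembly :
    (∀ (ι : Type) (γ : ι → ℝ),
      (∀ g : ℝ → ℂ, Literature.NumberTheory.LFunctions.IsWeilTest g →
        tsupport g ⊆ Set.Icc (-Real.log 2) (Real.log 2) →
        HasSum (fun i => Literature.NumberTheory.LFunctions.weilMellin g (1 / 2 + (γ i : ℂ) * Complex.I))
          (Literature.NumberTheory.LFunctions.weilFunctional g)) →
      ∃ C : ℝ, ∀ T : ℝ, 0 ≤ T →
        {i : ι | γ i ∈ Set.Icc 0 T}.Finite ∧
        |(({i : ι | γ i ∈ Set.Icc 0 T}.ncard : ℕ) : ℝ) -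
            Literature.NumberTheory.LFunctions.riemannSiegelTheta T / Real.pi| ≤ C * (1 + Real.log (1 + T))) →
    (∀ (ι : Type) (γ : ι → ℝ), (∀ R : ℝ, {i : ι | |γ i| ≤ R}.Finite) → {i : ι | 0 ≤ γ i}.Infinite →
      ∃ e : ℕ → ι, Function.Injective e ∧ Set.range e = {i : ι | 0 ≤ γ i} ∧ Monotone (fun n => γ (e n))) →
    (∀ (a p : ℕ → ℝ) (C : ℝ), Monotone a → (∀ n, 0 ≤ a n) → StrictMono p → (∀ n, 7 ≤ p n) →
      (∀ n : ℕ, Literature.NumberTheory.LFunctions.riemannSiegelTheta (p n) = ((n : ℝ) - 1 / 2) * Real.pi) →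
      (∀ T : ℝ, 0 ≤ T → {n : ℕ | a n ≤ T}.Finite ∧
        |(({n : ℕ | a n ≤ T}.ncard : ℕ) : ℝ) -
            Literature.NumberTheory.LFunctions.riemannSiegelTheta T / Real.pi| ≤ C * (1 + Real.log (1 + T))) →
      ∃ D : ℝ, ∀ n, |a n - p n| ≤ D) →
    ∀ (ι : Type) (γ : ι → ℝ),
      (∀ g : ℝ → ℂ, Literature.NumberTheory.LFunctions.IsWeilTest g →
        tsupport g ⊆ Set.Icc (-Real.log 2) (Real.log 2) →
        HasSum (fun i => Literature.NumberTheory.LFunctions.weilMellin g (1 / 2 + (γ i : ℂ) * Complex.I))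
          (Literature.NumberTheory.LFunctions.weilFunctional g)) →
      ∀ x : ℕ → ℝ, Function.Injective x →
        Set.range x = {t : ℝ | 7 ≤ |t| ∧ Real.cos (Literature.NumberTheory.LFunctions.riemannSiegelTheta t) = 0} →
        ∃ (D : ℝ) (δ : ℕ → ℝ), (∀ n, |δ n| ≤ D) ∧
          ∀ g : ℝ → ℂ, Literature.NumberTheory.LFunctions.IsWeilTest g →
            tsupport g ⊆ Set.Icc (-Real.log 2) (Real.log 2) →
            HasSum (fun n => Literature.NumberTheory.LFunctions.weilMellin g (1 / 2 + ((x n + δ n : ℝ) : ℂ) * Complex.I))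
              (Literature.NumberTheory.LFunctions.weilFunctional g) :=
  Summit.RiemannHypothesis.RiemannHypothesis.Theorems.SpectralTraceWindowTraceArch.stub_structureAssembly

/-! ## The kernel-checked composition: the one open stub implies the crux, by name -/

/-- **The six soft stubs compose** (pure logic over the six LANDED stubs; no `sorry`): a bounded
displacement design exact on every finite prefix of the dense family yields the crux. Stated with the
design statement as the ONLY hypothesis (the six proved statements are used directly). -/
theorem windowTraceArch_of_design (hdesign : Registered.stub_design) :
    Summit.RiemannHypothesis.RiemannHypothesis.Theses.SpectralTrace.WindowTraceArch := by
  obtain ⟨x, hxinj, hxrange, C, N, hprof⟩ := baseStatement_holds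
  obtain ⟨D, hdes⟩ := hdesign acuteAngleStatement_holds x hxinj hxrange
  obtain ⟨g, hg⟩ := denseFamilyStatement_holds
  choose δ hδD hδex using fun m => hdes g m hg.1
  have hev : ∀ j, ∀ᶠ k in atTop,
      HasSum (fun n => weilMellin (g j) (1 / 2 + ((x n + δ k n : ℝ) : ℂ) * I))
        (weilFunctional (g j)) := fun j =>
    Filter.eventually_atTop.2 ⟨j + 1, fun k hk => hδex k j (by omega)⟩
  obtain ⟨δ', hδ'D, hδ'ex⟩ := compactnessStatement_holds dominationStatement_holds x C D N g δ hprof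
    (fun j => (hg.1 j).1) hδD hev
  exact ⟨ℕ, fun n => x n + δ' n, fun f hf hfs => extensionOfDenseStatement_holds
    dominationStatement_holds g hg x C D N δ' hprof hδ'D hδ'ex f hf hfs⟩

/-- **The line concludes the crux BY NAME** from its single open registered stub `stub_design`
(the other six stubs — base, acuteAngle, domination, compactness, denseFamily, extensionOfDense —
are LANDED theorems of `Theorems/SpectralTraceWindowTraceArchStub*.lean`). Enumerate `FL` (base),
take for each `m` a design exact on the first `m` tests of the dense family (design, fed the acute-angle
lemma), pass to a limit displacement exact on the whole dense family (compactness, fed domination), and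
extend to every window test (extensionOfDense). Witness: `ι = ℕ`, `γ n = x n + δ' n`. -/
theorem WindowTraceArch_of (hdesign : Registered.stub_design) :
    Summit.RiemannHypothesis.RiemannHypothesis.Theses.SpectralTrace.WindowTraceArch :=
  windowTraceArch_of_design hdesign

/-- Wiring check: the registered stub feeds `WindowTraceArch_of` as stated (an `example`, so that no
sorry-tainted DECLARATION of this file has the crux as its type). -/
example : Summit.RiemannHypothesis.RiemannHypothesis.Theses.SpectralTrace.WindowTraceArch :=
  WindowTraceArch_of stub_design

/-- **Structure theorem (modulo the six wave-2 stubs): the crux implies the design statement.** Every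
witness is a bounded displacement of `FL`, so ONE displacement serves every finite test list. -/
theorem designStatement_of_windowTraceArch
    (h : Summit.RiemannHypothesis.RiemannHypothesis.Theses.SpectralTrace.WindowTraceArch) :
    DesignStatement := by
  intro _ x hxinj hxrange
  obtain ⟨ι, γ, hγ⟩ := h
  obtain ⟨D, δ, hδ, hw⟩ := stub_structureAssembly (stub_countingLaw stub_bandlimitedTest stub_selbergTests)
    stub_sortedEnumeration stub_displacementBound ι γ hγ x hxinj hxrange
  exact ⟨D, fun g _ hg => ⟨δ, hδ, fun j _ => hw (g j) (hg j).1 (hg j).2⟩⟩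

/-- **`stub_design` IS the crux** (modulo the six wave-2 stubs and given the six landed soft stubs):
`DesignStatement ↔ WindowTraceArch`. -/
theorem designStatement_iff_windowTraceArch :
    DesignStatement ↔ Summit.RiemannHypothesis.RiemannHypothesis.Theses.SpectralTrace.WindowTraceArch :=
  ⟨fun h => windowTraceArch_of_design h, designStatement_of_windowTraceArch⟩

end Summit.RiemannHypothesis.RiemannHypothesis.Cruxes.WindowTraceArch.DefectCompactnessDesign

end
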